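/-
Copyright: the b2b-balaban cell (near-miss cell 7), T⁴-continuum fan-out, lineage t4-ne7b-p1 (node U5c COUNT member).
Released under the licence of the surrounding project.
-/
import Summits.QuantumFields.BalabanUV.T4Continuum.Support.ZoneSkeleton

/-!
# Zone drivers: recent weighted formation activity bounds the zone factor (zone skeleton, part 2)

Summits-side support leaf of the T⁴-continuum cell (rung (B)+1 on a FINITE torus only; NOT infinite volume, NOT the
mass gap, NOT the Clay statement; NOT a proof of the spine estimate NE7b).  Lineage `t4-ne7b-p1`, node U5c, wall (GM),
located item G-ne7bp1g18-2 part (I), sequel of `Support/ZoneSkeleton.lean`.  [folklore] finite combinatorics ∕ real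
arithmetic, generic in the event type `ε` and the cell type `γ`; nothing quoted, nothing printed asserted, no `[cite:]`.

WHAT.  §4 the drivers: `form G = births ∪ merges`, the discounted weighted activity
`qZ wt σ st G t = Σ_{w ∈ form G} wt w·σ^{2(t − st w)}`, the displayed chronology `Chrono`, structural products
`mergeProd`, `mergeCount` (`= #merges` under `Gen.WF`), `combZ_le_mergeProd` (a merger-wise bound
`ext t X + ext t Y ≤ C₀·g` feeds a monotone `M`) and `ext_add_le_of_contraction`: the PER-STRUCTURE CONTRACTION LAW
`ext t X ≤ C₀ · qZ wt σ st X t` (DISPLAYED: extents are driven by recent weighted formation activity — blocking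
contracts, collars add, a birth of class `d′` is `d′+1` cubes wide) gives the merger-wise bound with the driver
`q_Z = qZ (merge X Y e) (st e)` at well-formed mergers.  §5 the polynomial touch count
`NZ r t s ≤ M₀ (r+1)^d Λ^{t+1−s}`:
**`card_admZSet_root_le_crowd`**: for a well-formed genealogy, the zone-admissible placements with the root at `c`
number at most `Λ^{partnerAges st G} · (M₀ (C₀+1)^d)^{mergeCount G} · mergeProd (q_Z^d) G` — one factor per merger, no
pair sum, no factorial; the last factor is what the weighted crowding theorem (`Support/CrowdingWeighted.lean`) pays
once `q_Z ≤ Q(wcnt G, σ, t_Z)` (chronology; `Support/ZoneCrowd.lean`).  §6 (v1.1): the MERGER-WISE form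
`card_admZSet_root_le_crowd_mergerwise` and the AFFINE law `ext t X ≤ C₀·qZ X t + c₀` (the realistic one — an old
quiet structure keeps extent `c₀` while its activity decays): `card_admZSet_root_le_crowd_affine` with the constant
`(M₀ (C₀ + 2c₀ + 1)^d)^{mergeCount}` (the merger's own weight `≥ 1` absorbs the constants).

WHAT THIS FILE DOES NOT DO ∕ LOCATED.  As in part 1: no instantiation of `near`, `NZ`, `ext`, `wt`, `C₀`, `M₀` (index
model + reading (ID), G-ne7bp1g9-1); renewals weigh nothing (located); NE7b discharge: no date.

HONEST DEPENDENCY (cell): continuum YM on T⁴ ⇐ BetaPertH ∧ nine spine estimates (0/9 proved); BetaPertH ⇐ (D1) ∧ (D4)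
∧ CAP+tail.  This file changes none of it.
-/

open Finset
open Literature.MathematicalPhysics.QuantumFieldTheory.Balaban1983to89
open T4PersistenceDictionary T4PartnerMultiplicity
open Summit.QuantumFields.BalabanUV.T4Continuum.PlacementSkeleton
open Summit.QuantumFields.BalabanUV.T4Continuum.Crowding

namespace Summit.QuantumFields.BalabanUV.T4Continuum.ZoneSkeleton

noncomputable section

variable {ε : Type*} [DecidableEq ε] {γ : Type*}

/-! ## §4 The drivers: recent weighted formation activity bounds the extents -/

/-- The FORMATION EVENTS of a genealogy: births and mergers. [folklore] -/
def form (G : Gen ε) : Finset ε := births G ∪ merges G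

/-- formation events are events [folklore] -/
theorem form_subset_events (G : Gen ε) : form G ⊆ G.events :=
  union_subset (births_subset_events G) (merges_subset_events G)

/-- CHRONOLOGY: at every merger, every formation event of the two partners is dated no later than the merger event
(true for histories read off a process; NOT implied by the dictionary's typed `Consistent`, hence displayed).
[folklore] -/
def Chrono (st : ε → ℕ) : Gen ε → Prop
  | Gen.born _ _ => True
  | Gen.renew G _ _ => Chrono st G
  | Gen.merge X Y e => Chrono st X ∧ Chrono st Y ∧ ∀ w ∈ form X ∪ form Y, st w ≤ st e

/-- THE DISCOUNTED WEIGHTED ACTIVITY of a structure at step `t`: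
`qZ wt σ st G t = Σ_{w ∈ form G} wt w · σ^{2(t − st w)}` (truncated ages; `σ² = 1∕L` in the chain). [folklore] -/
def qZ (wt : ε → ℝ) (σ : ℝ) (st : ε → ℕ) (G : Gen ε) (t : ℕ) : ℝ := ∑ w ∈ form G, wt w * σ ^ (2 * (t - st w))

omit [DecidableEq ε] in
/-- STRUCTURAL PRODUCT over the merge nodes of a factor read off the merged structure and its merger event.
[folklore] -/
def mergeProd (f : Gen ε → ε → ℝ) : Gen ε → ℝ
  | Gen.born _ _ => 1
  | Gen.renew G _ _ => mergeProd f G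
  | Gen.merge X Y e => mergeProd f X * mergeProd f Y * f (Gen.merge X Y e) e

omit [DecidableEq ε] in
/-- the number of merge NODES [folklore] -/
def mergeCount : Gen ε → ℕ
  | Gen.born _ _ => 0
  | Gen.renew G _ _ => mergeCount G
  | Gen.merge X Y _ => mergeCount X + mergeCount Y + 1

/-- Under well-formedness the merge nodes are as many as the merger events. [folklore] -/
theorem mergeCount_eq_card (W : ε → ℕ) : ∀ {G : Gen ε}, G.WF W → mergeCount G = (merges G).card
  | Gen.born b j, _ => by simp [mergeCount, merges]
  | Gen.renew G e h, hW => by simpa [mergeCount, merges] using mergeCount_eq_card W (G := G) hW.1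
  | Gen.merge X Y e, hW => by
      obtain ⟨heX, heY, hdM, -⟩ := merge_facts W hW
      have hXY : e ∉ merges X ∪ merges Y := by simp [heX, heY]
      rw [mergeCount, merges, card_insert_of_notMem hXY, card_union_of_disjoint hdM, mergeCount_eq_card W hW.1,
        mergeCount_eq_card W hW.2.1]

omit [DecidableEq ε] in
/-- `mergeProd ≥ 0` for a factor nonnegative at the merge nodes [folklore] -/
theorem mergeProd_nonneg (f : Gen ε → ε → ℝ) (hf : ∀ X Y e, 0 ≤ f (Gen.merge X Y e) e) :
    ∀ G : Gen ε, 0 ≤ mergeProd f G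
  | Gen.born _ _ => zero_le_one
  | Gen.renew G _ _ => mergeProd_nonneg f hf G
  | Gen.merge X Y _ => mul_nonneg (mul_nonneg (mergeProd_nonneg f hf X) (mergeProd_nonneg f hf Y)) (hf _ _ _)

omit [DecidableEq ε] in
/-- monotonicity of the structural product in the factor, compared AT THE MERGE NODES only [folklore] -/
theorem mergeProd_mono (f g : Gen ε → ε → ℝ) (hf : ∀ X Y e, 0 ≤ f (Gen.merge X Y e) e)
    (hfg : ∀ X Y e, f (Gen.merge X Y e) e ≤ g (Gen.merge X Y e) e) : ∀ G : Gen ε, mergeProd f G ≤ mergeProd g G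
  | Gen.born _ _ => le_rfl
  | Gen.renew G _ _ => mergeProd_mono f g hf hfg G
  | Gen.merge X Y e => by
      have ihX := mergeProd_mono f g hf hfg X
      have ihY := mergeProd_mono f g hf hfg Y
      have h0X := mergeProd_nonneg f hf X
      have h0Y := mergeProd_nonneg f hf Y
      rw [mergeProd, mergeProd]
      exact mul_le_mul (mul_le_mul ihX ihY h0Y (h0X.trans ihX)) (hfg _ _ _) (hf _ _ _)
        (mul_nonneg (h0X.trans ihX) (h0Y.trans ihY))

omit [DecidableEq ε] in
/-- the structural product of a product is the product of the structural products [folklore] -/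
theorem mergeProd_mul (f g : Gen ε → ε → ℝ) :
    ∀ G : Gen ε, mergeProd (fun Z e => f Z e * g Z e) G = mergeProd f G * mergeProd g G
  | Gen.born _ _ => by simp [mergeProd]
  | Gen.renew G _ _ => by simpa [mergeProd] using mergeProd_mul f g G
  | Gen.merge X Y e => by
      rw [mergeProd, mergeProd, mergeProd, mergeProd_mul f g X, mergeProd_mul f g Y]; ring

omit [DecidableEq ε] in
/-- the structural product of a constant is the constant to the number of merge nodes [folklore] -/
theorem mergeProd_const (c : ℝ) : ∀ G : Gen ε, mergeProd (fun _ _ => c) G = c ^ mergeCount G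
  | Gen.born _ _ => by simp [mergeProd, mergeCount]
  | Gen.renew G _ _ => by simpa [mergeProd, mergeCount] using mergeProd_const c G
  | Gen.merge X Y e => by
      rw [mergeProd, mergeCount, mergeProd_const c X, mergeProd_const c Y, pow_add, pow_add, pow_one]

/-- **A MERGER-WISE EXTENT BOUND FEEDS THE ZONE FACTOR.**  If at every well-formed merger the summed extents are at
most `C₀` times a driver `g (merge X Y e) e`, and `M` is monotone and nonnegative, then for every well-formed `G`,
`combZ M ext st G ≤ mergeProd (M ∘ (C₀·g)) G`. [folklore] -/
theorem combZ_le_mergeProd (W : ε → ℕ) (M : ℝ → ℝ) (hM : ∀ r, 0 ≤ M r) (hMmono : Monotone M)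
    (ext : ℕ → Gen ε → ℝ) (st : ε → ℕ) (C₀ : ℝ) (g : Gen ε → ε → ℝ)
    (hext : ∀ (X Y : Gen ε) (e : ε), (Gen.merge X Y e).WF W →
      ext (st e) X + ext (st e) Y ≤ C₀ * g (Gen.merge X Y e) e) :
    ∀ {G : Gen ε}, G.WF W → combZ M ext st G ≤ mergeProd (fun Z e => M (C₀ * g Z e)) G
  | Gen.born _ _, _ => le_rfl
  | Gen.renew G _ _, hW => combZ_le_mergeProd W M hM hMmono ext st C₀ g hext (G := G) hW.1
  | Gen.merge X Y e, hW => by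
      have ihX := combZ_le_mergeProd W M hM hMmono ext st C₀ g hext hW.1
      have ihY := combZ_le_mergeProd W M hM hMmono ext st C₀ g hext hW.2.1
      have cX := combZ_nonneg M hM ext st X
      have cY := combZ_nonneg M hM ext st Y
      rw [combZ, mergeProd]
      exact mul_le_mul (mul_le_mul ihX ihY cY (cX.trans ihX)) (hMmono (hext X Y e hW)) (hM _)
        (mul_nonneg (cX.trans ihX) (cY.trans ihY))

/-- The formation events of the two partners of a well-formed merger are disjoint. [folklore] -/
theorem disjoint_form (W : ε → ℕ) {X Y : Gen ε} {e : ε} (hW : (Gen.merge X Y e).WF W) :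
    Disjoint (form X) (form Y) :=
  hW.2.2.2.2.1.mono (form_subset_events X) (form_subset_events Y)

/-- **ADDITIVITY OF THE DRIVER AT A WELL-FORMED MERGER**: with nonnegative weights, the merged structure's activity
dominates the sum of the partners' (the own merger event adds `wt e ≥ 0`). [folklore] -/
theorem qZ_add_le (W : ε → ℕ) (wt : ε → ℝ) (hwt : ∀ w, 0 ≤ wt w) {σ : ℝ} (hσ : 0 ≤ σ) (st : ε → ℕ)
    {X Y : Gen ε} {e : ε} (hW : (Gen.merge X Y e).WF W) (t : ℕ) :
    qZ wt σ st X t + qZ wt σ st Y t ≤ qZ wt σ st (Gen.merge X Y e) t := by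
  unfold qZ
  have hsub : form X ∪ form Y ⊆ form (Gen.merge X Y e) := by
    intro w hw
    simp only [form, births_merge, merges, mem_union, mem_insert] at hw ⊢
    tauto
  rw [← sum_union (disjoint_form W hW)]
  exact sum_le_sum_of_subset_of_nonneg hsub fun w _ _ => mul_nonneg (hwt w) (pow_nonneg hσ _)

/-- Hence the PER-STRUCTURE CONTRACTION LAW `ext t X ≤ C₀ · qZ wt σ st X t` (`C₀ ≥ 0`) gives the merger-wise bound
used by `combZ_le_mergeProd`, with the driver `q_Z = qZ (merge X Y e) (st e)`. [folklore] -/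
theorem ext_add_le_of_contraction (W : ε → ℕ) (wt : ε → ℝ) (hwt : ∀ w, 0 ≤ wt w) {σ : ℝ} (hσ : 0 ≤ σ)
    (st : ε → ℕ) (ext : ℕ → Gen ε → ℝ) {C₀ : ℝ} (hC : 0 ≤ C₀) (hext : ∀ t X, ext t X ≤ C₀ * qZ wt σ st X t)
    (X Y : Gen ε) (e : ε) (hW : (Gen.merge X Y e).WF W) :
    ext (st e) X + ext (st e) Y ≤ C₀ * qZ wt σ st (Gen.merge X Y e) (st e) := by
  have h := mul_le_mul_of_nonneg_left (qZ_add_le W wt hwt hσ st hW (st e)) hC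
  rw [mul_add] at h
  linarith [hext (st e) X, hext (st e) Y]

/-- The driver at a merger is at least the merger's own weight: `wt e ≤ qZ (merge X Y e) (st e)`. [folklore] -/
theorem wt_le_qZ_merge (wt : ε → ℝ) (hwt : ∀ w, 0 ≤ wt w) {σ : ℝ} (hσ : 0 ≤ σ) (st : ε → ℕ) (X Y : Gen ε)
    (e : ε) : wt e ≤ qZ wt σ st (Gen.merge X Y e) (st e) := by
  unfold qZ
  have he : e ∈ form (Gen.merge X Y e) := by simp [form, merges]
  have h := single_le_sum (s := form (Gen.merge X Y e)) (f := fun w => wt w * σ ^ (2 * (st e - st w)))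
    (fun w _ => mul_nonneg (hwt w) (pow_nonneg hσ _)) he
  simpa using h

/-! ## §5 The polynomial touch count -/

/-- For `q ≥ 1`, `C₀ ≥ 0`: `(C₀ q + 1)^d ≤ (C₀ + 1)^d · q^d`. [folklore] -/
theorem pow_touch_le {C₀ q : ℝ} (hC : 0 ≤ C₀) (hq : 1 ≤ q) (d : ℕ) :
    (C₀ * q + 1) ^ d ≤ (C₀ + 1) ^ d * q ^ d := by
  rw [← mul_pow]
  exact pow_le_pow_left₀ (by positivity) (by nlinarith) d

section Final

variable [Fintype ε] [Fintype γ] [DecidableEq γ]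

open scoped Classical

/-- **THE ZONE-FORM MULTIPLICITY WITH THE CROWDING FACTOR DISPLAYED.**  Root-position bounds `hN1`∕`hN2`; the fibre
shape `NZ r t s ≤ M₀ (r+1)^d Λ^{t+1−s}` on `r ≥ 0`; weights `wt ≥ 1`; `σ ≥ 0`; nonnegative extents obeying the
per-structure contraction law `ext t X ≤ C₀ · qZ wt σ st X t`.  Then for a WELL-FORMED genealogy,
`#admZSet G root c c₀ ≤ Λ^{partnerAges st G} · (M₀ (C₀+1)^d)^{mergeCount G} · mergeProd (q_Z^d) G`,
`q_Z = qZ wt σ st Z (st e_Z)` — no pair sum, no factorial; the last factor is the weighted crowding theorem's.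
[folklore] -/
theorem card_admZSet_root_le_crowd (W : ε → ℕ) (near : γ → ℕ → γ → ℕ → ℕ → ℝ → Prop) (ext : ℕ → Gen ε → ℝ)
    (hext0 : ∀ t X, 0 ≤ ext t X) (st : ε → ℕ) (NZ : ℝ → ℕ → ℕ → ℕ) {M₀ Λ C₀ σ : ℝ} (hM₀ : 0 ≤ M₀) (hΛ : 0 ≤ Λ)
    (hC : 0 ≤ C₀) (hσ : 0 ≤ σ) (d : ℕ)
    (hN1 : ∀ (x : γ) (sx sy t : ℕ) (r : ℝ), (univ.filter fun y : γ => near x sx y sy t r).card ≤ NZ r t sy)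
    (hN2 : ∀ (y : γ) (sx sy t : ℕ) (r : ℝ), (univ.filter fun x : γ => near x sx y sy t r).card ≤ NZ r t sx)
    (hNZ : ∀ r t s, 0 ≤ r → (NZ r t s : ℝ) ≤ M₀ * (r + 1) ^ d * Λ ^ (t + 1 - s))
    (wt : ε → ℝ) (hwt : ∀ w, 1 ≤ wt w) (hext : ∀ t X, ext t X ≤ C₀ * qZ wt σ st X t)
    {G : Gen ε} (hW : G.WF W) (c c₀ : γ) :
    ((admZSet near ext st G G.root c c₀).card : ℝ) ≤ Λ ^ partnerAges st G *
      ((M₀ * (C₀ + 1) ^ d) ^ mergeCount G * mergeProd (fun Z e => qZ wt σ st Z (st e) ^ d) G) := by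
  have hwt0 : ∀ w, 0 ≤ wt w := fun w => zero_le_one.trans (hwt w)
  -- the touch-count shape, made total and monotone on all reals by `max 0`
  set M : ℝ → ℝ := fun r => M₀ * (max 0 r + 1) ^ d with hMdef
  have hM : ∀ r, 0 ≤ M r := fun r => by positivity
  have hMmono : Monotone M := fun a b hab =>
    mul_le_mul_of_nonneg_left (pow_le_pow_left₀ (by positivity) (by simp [max_le_max le_rfl hab]) d) hM₀
  have hNZ' : ∀ r t s, 0 ≤ r → (NZ r t s : ℝ) ≤ M r * Λ ^ (t + 1 - s) := fun r t s hr => by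
    simpa [hMdef, max_eq_right hr] using hNZ r t s hr
  -- (1) skeleton + exponent
  have h1 := card_admZSet_root_le near ext hext0 st NZ M hM hΛ hN1 hN2 hNZ' G (separated_of_wf W hW) c c₀
  -- (2) contraction law
  have h2 : combZ M ext st G ≤ mergeProd (fun Z e => M (C₀ * qZ wt σ st Z (st e))) G :=
    combZ_le_mergeProd W M hM hMmono ext st C₀ (fun Z e => qZ wt σ st Z (st e))
      (fun X Y e hWm => ext_add_le_of_contraction W wt hwt0 hσ st ext hC hext X Y e hWm) hW
  -- (3) the polynomial at drivers `≥ 1`, merge node by merge node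
  have h3 : mergeProd (fun Z e => M (C₀ * qZ wt σ st Z (st e))) G ≤
      mergeProd (fun Z e => (M₀ * (C₀ + 1) ^ d) * qZ wt σ st Z (st e) ^ d) G := by
    refine mergeProd_mono _ _ (fun _ _ _ => hM _) (fun X Y e => ?_) G
    have hq : 1 ≤ qZ wt σ st (Gen.merge X Y e) (st e) := (hwt e).trans (wt_le_qZ_merge wt hwt0 hσ st X Y e)
    have hmax : max 0 (C₀ * qZ wt σ st (Gen.merge X Y e) (st e)) = C₀ * qZ wt σ st (Gen.merge X Y e) (st e) :=
      max_eq_right (by positivity)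
    simp only [hMdef, hmax]
    rw [mul_assoc]
    exact mul_le_mul_of_nonneg_left (pow_touch_le hC hq d) hM₀
  -- (4) split the constant off
  have h4 : mergeProd (fun Z e => (M₀ * (C₀ + 1) ^ d) * qZ wt σ st Z (st e) ^ d) G =
      (M₀ * (C₀ + 1) ^ d) ^ mergeCount G * mergeProd (fun Z e => qZ wt σ st Z (st e) ^ d) G := by
    rw [← mergeProd_const, ← mergeProd_mul]
  calc ((admZSet near ext st G G.root c c₀).card : ℝ) ≤ Λ ^ partnerAges st G * combZ M ext st G := h1
    _ ≤ Λ ^ partnerAges st G * mergeProd (fun Z e => (M₀ * (C₀ + 1) ^ d) * qZ wt σ st Z (st e) ^ d) G :=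
        mul_le_mul_of_nonneg_left (h2.trans h3) (pow_nonneg hΛ _)
    _ = _ := by rw [h4]

end Final

/-! ## §6 The merger-wise and the AFFINE contraction law (v1.1)

The per-structure law `ext t X ≤ C₀ · qZ X t` of `card_admZSet_root_le_crowd` is too strong for real zones: an old,
quiet structure keeps an extent of order one (one cell plus collars, `c₀`) while its activity `qZ X t` decays to `0`.
What the skeleton actually consumes is the MERGER-WISE bound `ext t X + ext t Y ≤ C₀ · q_{merge X Y e}(t)` at
`t = st e`, and that follows from the AFFINE law `ext t X ≤ C₀ · qZ X t + c₀` because the merger's own event gives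
`q_{merge}(st e) ≥ wt e ≥ 1`, which absorbs the two constants: `C₀ ↦ C₀ + 2c₀`. -/

/-- **AFFINE CONTRACTION LAW ⇒ MERGER-WISE BOUND.**  If `ext t X ≤ C₀ · qZ wt σ st X t + c₀` for all structures
(`C₀, c₀ ≥ 0`, weights `≥ 1` on merger events, `σ ≥ 0`), then at every well-formed merger
`ext (st e) X + ext (st e) Y ≤ (C₀ + 2c₀) · qZ wt σ st (merge X Y e) (st e)`. [folklore] -/
theorem ext_add_le_of_affine (W : ε → ℕ) (wt : ε → ℝ) (hwt : ∀ w, 1 ≤ wt w) {σ : ℝ} (hσ : 0 ≤ σ) (st : ε → ℕ)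
    (ext : ℕ → Gen ε → ℝ) {C₀ c₀ : ℝ} (hC : 0 ≤ C₀) (hc : 0 ≤ c₀)
    (hext : ∀ t X, ext t X ≤ C₀ * qZ wt σ st X t + c₀) (X Y : Gen ε) (e : ε) (hW : (Gen.merge X Y e).WF W) :
    ext (st e) X + ext (st e) Y ≤ (C₀ + 2 * c₀) * qZ wt σ st (Gen.merge X Y e) (st e) := by
  have hwt0 : ∀ w, 0 ≤ wt w := fun w => zero_le_one.trans (hwt w)
  have hadd := mul_le_mul_of_nonneg_left (qZ_add_le W wt hwt0 hσ st hW (st e)) hC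
  have hq1 : 1 ≤ qZ wt σ st (Gen.merge X Y e) (st e) := (hwt e).trans (wt_le_qZ_merge wt hwt0 hσ st X Y e)
  rw [mul_add] at hadd
  have h2c : 2 * c₀ ≤ 2 * c₀ * qZ wt σ st (Gen.merge X Y e) (st e) := by nlinarith
  calc ext (st e) X + ext (st e) Y ≤ (C₀ * qZ wt σ st X (st e) + c₀) + (C₀ * qZ wt σ st Y (st e) + c₀) :=
        add_le_add (hext _ _) (hext _ _)
    _ ≤ C₀ * qZ wt σ st (Gen.merge X Y e) (st e) + 2 * c₀ * qZ wt σ st (Gen.merge X Y e) (st e) := by linarith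
    _ = (C₀ + 2 * c₀) * qZ wt σ st (Gen.merge X Y e) (st e) := by ring

section FinalMergerwise

variable [Fintype ε] [Fintype γ] [DecidableEq γ]

open scoped Classical

/-- **THE ZONE-FORM MULTIPLICITY FROM A MERGER-WISE EXTENT BOUND.**  As `card_admZSet_root_le_crowd`, but the extents
are controlled only AT MERGERS: `ext (st e) X + ext (st e) Y ≤ C₀ · qZ wt σ st (merge X Y e) (st e)` at every
well-formed merger node.  Conclusion unchanged:
`#admZSet G root c c₀ ≤ Λ^{partnerAges st G} · (M₀ (C₀+1)^d)^{mergeCount G} · mergeProd (q_Z^d) G`. [folklore] -/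
theorem card_admZSet_root_le_crowd_mergerwise (W : ε → ℕ) (near : γ → ℕ → γ → ℕ → ℕ → ℝ → Prop)
    (ext : ℕ → Gen ε → ℝ) (hext0 : ∀ t X, 0 ≤ ext t X) (st : ε → ℕ) (NZ : ℝ → ℕ → ℕ → ℕ) {M₀ Λ C₀ σ : ℝ}
    (hM₀ : 0 ≤ M₀) (hΛ : 0 ≤ Λ) (hC : 0 ≤ C₀) (hσ : 0 ≤ σ) (d : ℕ)
    (hN1 : ∀ (x : γ) (sx sy t : ℕ) (r : ℝ), (univ.filter fun y : γ => near x sx y sy t r).card ≤ NZ r t sy)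
    (hN2 : ∀ (y : γ) (sx sy t : ℕ) (r : ℝ), (univ.filter fun x : γ => near x sx y sy t r).card ≤ NZ r t sx)
    (hNZ : ∀ r t s, 0 ≤ r → (NZ r t s : ℝ) ≤ M₀ * (r + 1) ^ d * Λ ^ (t + 1 - s))
    (wt : ε → ℝ) (hwt : ∀ w, 1 ≤ wt w)
    (hextM : ∀ (X Y : Gen ε) (e : ε), (Gen.merge X Y e).WF W →
      ext (st e) X + ext (st e) Y ≤ C₀ * qZ wt σ st (Gen.merge X Y e) (st e))
    {G : Gen ε} (hW : G.WF W) (c c₀ : γ) :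
    ((admZSet near ext st G G.root c c₀).card : ℝ) ≤ Λ ^ partnerAges st G *
      ((M₀ * (C₀ + 1) ^ d) ^ mergeCount G * mergeProd (fun Z e => qZ wt σ st Z (st e) ^ d) G) := by
  have hwt0 : ∀ w, 0 ≤ wt w := fun w => zero_le_one.trans (hwt w)
  set M : ℝ → ℝ := fun r => M₀ * (max 0 r + 1) ^ d with hMdef
  have hM : ∀ r, 0 ≤ M r := fun r => by positivity
  have hMmono : Monotone M := fun a b hab =>
    mul_le_mul_of_nonneg_left (pow_le_pow_left₀ (by positivity) (by simp [max_le_max le_rfl hab]) d) hM₀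
  have hNZ' : ∀ r t s, 0 ≤ r → (NZ r t s : ℝ) ≤ M r * Λ ^ (t + 1 - s) := fun r t s hr => by
    simpa [hMdef, max_eq_right hr] using hNZ r t s hr
  have h1 := card_admZSet_root_le near ext hext0 st NZ M hM hΛ hN1 hN2 hNZ' G (separated_of_wf W hW) c c₀
  have h2 : combZ M ext st G ≤ mergeProd (fun Z e => M (C₀ * qZ wt σ st Z (st e))) G :=
    combZ_le_mergeProd W M hM hMmono ext st C₀ (fun Z e => qZ wt σ st Z (st e)) hextM hW
  have h3 : mergeProd (fun Z e => M (C₀ * qZ wt σ st Z (st e))) G ≤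
      mergeProd (fun Z e => (M₀ * (C₀ + 1) ^ d) * qZ wt σ st Z (st e) ^ d) G := by
    refine mergeProd_mono _ _ (fun _ _ _ => hM _) (fun X Y e => ?_) G
    have hq : 1 ≤ qZ wt σ st (Gen.merge X Y e) (st e) := (hwt e).trans (wt_le_qZ_merge wt hwt0 hσ st X Y e)
    have hmax : max 0 (C₀ * qZ wt σ st (Gen.merge X Y e) (st e)) = C₀ * qZ wt σ st (Gen.merge X Y e) (st e) :=
      max_eq_right (by positivity)
    simp only [hMdef, hmax]
    rw [mul_assoc]
    exact mul_le_mul_of_nonneg_left (pow_touch_le hC hq d) hM₀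
  have h4 : mergeProd (fun Z e => (M₀ * (C₀ + 1) ^ d) * qZ wt σ st Z (st e) ^ d) G =
      (M₀ * (C₀ + 1) ^ d) ^ mergeCount G * mergeProd (fun Z e => qZ wt σ st Z (st e) ^ d) G := by
    rw [← mergeProd_const, ← mergeProd_mul]
  calc ((admZSet near ext st G G.root c c₀).card : ℝ) ≤ Λ ^ partnerAges st G * combZ M ext st G := h1
    _ ≤ Λ ^ partnerAges st G * mergeProd (fun Z e => (M₀ * (C₀ + 1) ^ d) * qZ wt σ st Z (st e) ^ d) G :=
        mul_le_mul_of_nonneg_left (h2.trans h3) (pow_nonneg hΛ _)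
    _ = _ := by rw [h4]

/-- **THE ZONE-FORM MULTIPLICITY UNDER THE AFFINE CONTRACTION LAW** `ext t X ≤ C₀ · qZ wt σ st X t + c₀` (the
realistic law: an old quiet structure keeps extent `c₀`):
`#admZSet G root c c₀' ≤ Λ^{partnerAges st G} · (M₀ (C₀ + 2c₀ + 1)^d)^{mergeCount G} · mergeProd (q_Z^d) G`.
[folklore] -/
theorem card_admZSet_root_le_crowd_affine (W : ε → ℕ) (near : γ → ℕ → γ → ℕ → ℕ → ℝ → Prop)
    (ext : ℕ → Gen ε → ℝ) (hext0 : ∀ t X, 0 ≤ ext t X) (st : ε → ℕ) (NZ : ℝ → ℕ → ℕ → ℕ) {M₀ Λ C₀ c₀ σ : ℝ}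
    (hM₀ : 0 ≤ M₀) (hΛ : 0 ≤ Λ) (hC : 0 ≤ C₀) (hc : 0 ≤ c₀) (hσ : 0 ≤ σ) (d : ℕ)
    (hN1 : ∀ (x : γ) (sx sy t : ℕ) (r : ℝ), (univ.filter fun y : γ => near x sx y sy t r).card ≤ NZ r t sy)
    (hN2 : ∀ (y : γ) (sx sy t : ℕ) (r : ℝ), (univ.filter fun x : γ => near x sx y sy t r).card ≤ NZ r t sx)
    (hNZ : ∀ r t s, 0 ≤ r → (NZ r t s : ℝ) ≤ M₀ * (r + 1) ^ d * Λ ^ (t + 1 - s))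
    (wt : ε → ℝ) (hwt : ∀ w, 1 ≤ wt w) (hext : ∀ t X, ext t X ≤ C₀ * qZ wt σ st X t + c₀)
    {G : Gen ε} (hW : G.WF W) (c c₀' : γ) :
    ((admZSet near ext st G G.root c c₀').card : ℝ) ≤ Λ ^ partnerAges st G *
      ((M₀ * (C₀ + 2 * c₀ + 1) ^ d) ^ mergeCount G * mergeProd (fun Z e => qZ wt σ st Z (st e) ^ d) G) :=
  card_admZSet_root_le_crowd_mergerwise W near ext hext0 st NZ hM₀ hΛ (by positivity) hσ d hN1 hN2 hNZ wt hwt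
    (fun X Y e hWm => ext_add_le_of_affine W wt hwt hσ st ext hC hc hext X Y e hWm) hW c c₀'

end FinalMergerwise

end

end Summit.QuantumFields.BalabanUV.T4Continuum.ZoneSkeleton
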